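import Mathlib.Tactic

/-!
# THE `g = 4` CASCADE: THE ARITHMETIC (night-3 g15)
The weights of the `4`-circuit cascade (the `g = 4` instance of the type-weight LP of `C025ProfileThinGirthD`), solved inside-out as
`C025ProfileCascadeArith` does for `g = 3`: `s_Q = 3/(4(q−2))` (the `Q'`-capacity exactly), `a₃ = 1 + 1/f − s_Q` (the top demand
exactly), `b₂ = (q + 1 − (q − 2) a₃)/3` (the capacity at `s = 3`), `a₂ = (f + 1 − 2 b₂)/(f − 1)` (the demand of type 2),
`b₁ = (q + 1 − (q − 1) a₂)/2` (the capacity at `s = 2`), `a₁ = (f + 1 − 3 b₁)/(f − 2)` (the demand of type 1), `b₀ = q + 1 − q a₁`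
(the capacity at `s = 1`), `a₀ = 1`; the only inequality left is the demand of type 0, `4 b₀ + (f − 3) ≥ f ⟺ b₀ ≥ 3/4`, the KEY.
Closed forms: `b₀ = (12f³ − 36f² + (9q² − 9q + 24) f − 12 q (q−1)(q−2)) / (12 f (f−1)(f−2))`, and the key polynomial
`12f³ − 36f² + (9q² − 9q + 24)f − 12q(q−1)(q−2) − 9f(f−1)(f−2)` equals, with `q = 6 + e`, `f = q + d`,
`540 + 492d + 45d² + 3d³ + 198e + 189ed + 9ed² + 18e² + 18e²d ≥ 0`: every inequality below is a polynomial with nonnegative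
coefficients in `(e, d)` after that substitution (`lab/g4poly.py`, exact). `g4_weights`: nonnegativity, the bound `4/3` (the σ need,
`σ = 4/(3f)`), the key, and the exact demands and capacities, for every `f ≥ q ≥ 6`. No matroid in this file.
-/
namespace PercRepro
namespace ThinGirth

/-- The `g = 4` cascade weights (inside-out chain): `s_Q = 3/(4(q−2))`, `a₃ = 1 + 1/f − s_Q`, `b₂ = (q + 1 − (q − 2) a₃)/3`,
`a₂ = (f + 1 − 2 b₂)/(f − 1)`, `b₁ = (q + 1 − (q − 1) a₂)/2`, `a₁ = (f + 1 − 3 b₁)/(f − 2)`, `b₀ = q + 1 − q a₁`, `a₀ = 1`: nonnegative,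
at most `4/3`, the demands (types 1, 2, the top type) and the capacities (`s = 1, 2, 3`, the `Q'`-sets) exact, and the KEY inequality
`b₀ ≥ 3/4` (the type-0 demand), for every `f ≥ q ≥ 6`. -/
theorem g4_weights {q f : ℕ} (hq : 6 ≤ q) (hf : q ≤ f) :
    let sQ : ℚ := 3 / (4 * ((q : ℚ) - 2))
    let a3 : ℚ := 1 + 1 / (f : ℚ) - sQ
    let b2 : ℚ := ((q : ℚ) + 1 - ((q : ℚ) - 2) * a3) / 3
    let a2 : ℚ := ((f : ℚ) + 1 - 2 * b2) / ((f : ℚ) - 1)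
    let b1 : ℚ := ((q : ℚ) + 1 - ((q : ℚ) - 1) * a2) / 2
    let a1 : ℚ := ((f : ℚ) + 1 - 3 * b1) / ((f : ℚ) - 2)
    let b0 : ℚ := (q : ℚ) + 1 - (q : ℚ) * a1
    (0 ≤ a1 ∧ 0 ≤ a2 ∧ 0 ≤ a3 ∧ 0 ≤ b0 ∧ 0 ≤ b1 ∧ 0 ≤ b2 ∧ 0 ≤ sQ) ∧
    (a1 ≤ 4 / 3 ∧ a2 ≤ 4 / 3 ∧ a3 ≤ 4 / 3 ∧ b0 ≤ 4 / 3 ∧ b1 ≤ 4 / 3 ∧ b2 ≤ 4 / 3) ∧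
    (3 / 4 ≤ b0 ∧ 2 * b2 + ((f : ℚ) - 1) * a2 = f + 1 ∧ 3 * b1 + ((f : ℚ) - 2) * a1 = f + 1 ∧
      (f : ℚ) * (a3 + sQ) = f + 1) ∧
    (b0 + (q : ℚ) * a1 = q + 1 ∧ 2 * b1 + ((q : ℚ) - 1) * a2 = q + 1 ∧ 3 * b2 + ((q : ℚ) - 2) * a3 = q + 1 ∧
      ((q : ℚ) - 2) + 4 * ((q : ℚ) - 2) * sQ = q + 1) := by
  intro sQ a3 b2 a2 b1 a1 b0
  have hq6 : (6 : ℚ) ≤ q := by exact_mod_cast hq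
  have hqf : (q : ℚ) ≤ f := by exact_mod_cast hf
  obtain ⟨e, he0, hqe⟩ : ∃ e : ℚ, 0 ≤ e ∧ (q : ℚ) = 6 + e := ⟨(q : ℚ) - 6, by linarith, by ring⟩
  obtain ⟨d, hd0, hfd⟩ : ∃ d : ℚ, 0 ≤ d ∧ (f : ℚ) = 6 + e + d := ⟨(f : ℚ) - q, by linarith, by rw [hqe]; ring⟩
  have hf0 : (f : ℚ) ≠ 0 := by rw [hfd]; positivity
  have hf1 : (f : ℚ) - 1 ≠ 0 := by rw [hfd]; intro h; linarith
  have hf2 : (f : ℚ) - 2 ≠ 0 := by rw [hfd]; intro h; linarith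
  have hq2 : (q : ℚ) - 2 ≠ 0 := by rw [hqe]; intro h; linarith
  have hfpos : (0 : ℚ) < f := by rw [hfd]; positivity
  have hf1pos : (0 : ℚ) < (f : ℚ) - 1 := by rw [hfd]; linarith
  have hf2pos : (0 : ℚ) < (f : ℚ) - 2 := by rw [hfd]; linarith
  have hq2pos : (0 : ℚ) < (q : ℚ) - 2 := by rw [hqe]; linarith
  -- closed forms
  have hsQ : sQ = 3 / (4 * ((q : ℚ) - 2)) := rfl
  have ha3 : a3 = ((-8 : ℚ) + (-11 : ℚ) * (f:ℚ) + (4 : ℚ) * (q:ℚ) + (4 : ℚ) * (q:ℚ) * (f:ℚ)) / (4 * (f : ℚ) * ((q : ℚ) - 2)) := by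
    simp only [a3, sQ]; field_simp; ring
  have hb2 : b2 = ((8 : ℚ) + (15 : ℚ) * (f:ℚ) + (-4 : ℚ) * (q:ℚ)) / ((12 : ℚ) * (f:ℚ)) := by
    simp only [b2, a3, sQ]; field_simp; ring
  have ha2 : a2 = ((-8 : ℚ) + (-9 : ℚ) * (f:ℚ) + (6 : ℚ) * (f:ℚ) ^ 2 + (4 : ℚ) * (q:ℚ)) / (6 * (f : ℚ) * ((f : ℚ) - 1)) := by
    simp only [a2, b2, a3, sQ]; field_simp; ring
  have hb1 : b1 = ((-8 : ℚ) + (-15 : ℚ) * (f:ℚ) + (12 : ℚ) * (f:ℚ) ^ 2 + (12 : ℚ) * (q:ℚ) + (3 : ℚ) * (q:ℚ) * (f:ℚ) +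
      (-4 : ℚ) * (q:ℚ) ^ 2) / (12 * (f : ℚ) * ((f : ℚ) - 1)) := by
    simp only [b1, a2, b2, a3, sQ]; field_simp; ring
  have ha1 : a1 = ((24 : ℚ) + (33 : ℚ) * (f:ℚ) + (-36 : ℚ) * (f:ℚ) ^ 2 + (12 : ℚ) * (f:ℚ) ^ 3 + (-36 : ℚ) * (q:ℚ) +
      (-9 : ℚ) * (q:ℚ) * (f:ℚ) + (12 : ℚ) * (q:ℚ) ^ 2) / (12 * (f : ℚ) * ((f : ℚ) - 1) * ((f : ℚ) - 2)) := by
    simp only [a1, b1, a2, b2, a3, sQ]; field_simp; ring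
  have hb0 : b0 = ((24 : ℚ) * (f:ℚ) + (-36 : ℚ) * (f:ℚ) ^ 2 + (12 : ℚ) * (f:ℚ) ^ 3 + (-24 : ℚ) * (q:ℚ) + (-9 : ℚ) * (q:ℚ) * (f:ℚ) +
      (36 : ℚ) * (q:ℚ) ^ 2 + (9 : ℚ) * (q:ℚ) ^ 2 * (f:ℚ) + (-12 : ℚ) * (q:ℚ) ^ 3) /
      (12 * (f : ℚ) * ((f : ℚ) - 1) * ((f : ℚ) - 2)) := by
    simp only [b0, a1, b1, a2, b2, a3, sQ]; field_simp; ring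
  have hden1 : (0 : ℚ) < 4 * (f : ℚ) * ((q : ℚ) - 2) := by positivity
  have hden2 : (0 : ℚ) < (12 : ℚ) * (f : ℚ) := by positivity
  have hden3 : (0 : ℚ) < 6 * (f : ℚ) * ((f : ℚ) - 1) := by positivity
  have hden4 : (0 : ℚ) < 12 * (f : ℚ) * ((f : ℚ) - 1) := by positivity
  have hden5 : (0 : ℚ) < 12 * (f : ℚ) * ((f : ℚ) - 1) * ((f : ℚ) - 2) := by positivity
  -- the numerators in `(e, d)`
  have n3 : (-8 : ℚ) + (-11 : ℚ) * (f:ℚ) + (4 : ℚ) * (q:ℚ) + (4 : ℚ) * (q:ℚ) * (f:ℚ) =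
      (94 : ℚ) + (13 : ℚ) * d + (41 : ℚ) * e + (4 : ℚ) * e * d + (4 : ℚ) * e ^ 2 := by rw [hqe, hfd]; ring
  have nb2 : (8 : ℚ) + (15 : ℚ) * (f:ℚ) + (-4 : ℚ) * (q:ℚ) = (74 : ℚ) + (15 : ℚ) * d + (11 : ℚ) * e := by rw [hqe, hfd]; ring
  have n2 : (-8 : ℚ) + (-9 : ℚ) * (f:ℚ) + (6 : ℚ) * (f:ℚ) ^ 2 + (4 : ℚ) * (q:ℚ) =
      (178 : ℚ) + (63 : ℚ) * d + (6 : ℚ) * d ^ 2 + (67 : ℚ) * e + (12 : ℚ) * e * d + (6 : ℚ) * e ^ 2 := by rw [hqe, hfd]; ring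
  have nb1 : (-8 : ℚ) + (-15 : ℚ) * (f:ℚ) + (12 : ℚ) * (f:ℚ) ^ 2 + (12 : ℚ) * (q:ℚ) + (3 : ℚ) * (q:ℚ) * (f:ℚ) + (-4 : ℚ) * (q:ℚ) ^ 2 =
      (370 : ℚ) + (147 : ℚ) * d + (12 : ℚ) * d ^ 2 + (129 : ℚ) * e + (27 : ℚ) * e * d + (11 : ℚ) * e ^ 2 := by rw [hqe, hfd]; ring
  have n1 : (24 : ℚ) + (33 : ℚ) * (f:ℚ) + (-36 : ℚ) * (f:ℚ) ^ 2 + (12 : ℚ) * (f:ℚ) ^ 3 + (-36 : ℚ) * (q:ℚ) + (-9 : ℚ) * (q:ℚ) * (f:ℚ) +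
      (12 : ℚ) * (q:ℚ) ^ 2 = (1410 : ℚ) + (843 : ℚ) * d + (180 : ℚ) * d ^ 2 + (12 : ℚ) * d ^ 3 + (897 : ℚ) * e + (351 : ℚ) * e * d +
      (36 : ℚ) * e * d ^ 2 + (183 : ℚ) * e ^ 2 + (36 : ℚ) * e ^ 2 * d + (12 : ℚ) * e ^ 3 := by rw [hqe, hfd]; ring
  have nb0 : (24 : ℚ) * (f:ℚ) + (-36 : ℚ) * (f:ℚ) ^ 2 + (12 : ℚ) * (f:ℚ) ^ 3 + (-24 : ℚ) * (q:ℚ) + (-9 : ℚ) * (q:ℚ) * (f:ℚ) +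
      (36 : ℚ) * (q:ℚ) ^ 2 + (9 : ℚ) * (q:ℚ) ^ 2 * (f:ℚ) + (-12 : ℚ) * (q:ℚ) ^ 3 =
      (1620 : ℚ) + (1158 : ℚ) * d + (180 : ℚ) * d ^ 2 + (12 : ℚ) * d ^ 3 + (864 : ℚ) * e + (459 : ℚ) * e * d +
      (36 : ℚ) * e * d ^ 2 + (153 : ℚ) * e ^ 2 + (45 : ℚ) * e ^ 2 * d + (9 : ℚ) * e ^ 3 := by rw [hqe, hfd]; ring
  refine ⟨⟨?_, ?_, ?_, ?_, ?_, ?_, ?_⟩, ⟨?_, ?_, ?_, ?_, ?_, ?_⟩, ⟨?_, ?_, ?_, ?_⟩, ⟨?_, ?_, ?_, ?_⟩⟩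
  · rw [ha1]; apply div_nonneg _ hden5.le; rw [n1]; positivity
  · rw [ha2]; apply div_nonneg _ hden3.le; rw [n2]; positivity
  · rw [ha3]; apply div_nonneg _ hden1.le; rw [n3]; positivity
  · rw [hb0]; apply div_nonneg _ hden5.le; rw [nb0]; positivity
  · rw [hb1]; apply div_nonneg _ hden4.le; rw [nb1]; positivity
  · rw [hb2]; apply div_nonneg _ hden2.le; rw [nb2]; positivity
  · rw [hsQ]; positivity
  · rw [ha1, div_le_iff₀ hden5]
    have : (4 : ℚ) / 3 * (12 * (f : ℚ) * ((f : ℚ) - 1) * ((f : ℚ) - 2)) -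
        ((24 : ℚ) + (33 : ℚ) * (f:ℚ) + (-36 : ℚ) * (f:ℚ) ^ 2 + (12 : ℚ) * (f:ℚ) ^ 3 + (-36 : ℚ) * (q:ℚ) + (-9 : ℚ) * (q:ℚ) * (f:ℚ) +
        (12 : ℚ) * (q:ℚ) ^ 2) = (510 : ℚ) + (341 : ℚ) * d + (60 : ℚ) * d ^ 2 + (4 : ℚ) * d ^ 3 + (287 : ℚ) * e + (129 : ℚ) * e * d +
        (12 : ℚ) * e * d ^ 2 + (57 : ℚ) * e ^ 2 + (12 : ℚ) * e ^ 2 * d + (4 : ℚ) * e ^ 3 := by rw [hqe, hfd]; ring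
    have h0 : (0 : ℚ) ≤ (510 : ℚ) + (341 : ℚ) * d + (60 : ℚ) * d ^ 2 + (4 : ℚ) * d ^ 3 + (287 : ℚ) * e + (129 : ℚ) * e * d +
        (12 : ℚ) * e * d ^ 2 + (57 : ℚ) * e ^ 2 + (12 : ℚ) * e ^ 2 * d + (4 : ℚ) * e ^ 3 := by positivity
    linarith
  · rw [ha2, div_le_iff₀ hden3]
    have : (4 : ℚ) / 3 * (6 * (f : ℚ) * ((f : ℚ) - 1)) - ((-8 : ℚ) + (-9 : ℚ) * (f:ℚ) + (6 : ℚ) * (f:ℚ) ^ 2 + (4 : ℚ) * (q:ℚ)) =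
        (62 : ℚ) + (25 : ℚ) * d + (2 : ℚ) * d ^ 2 + (21 : ℚ) * e + (4 : ℚ) * e * d + (2 : ℚ) * e ^ 2 := by rw [hqe, hfd]; ring
    have h0 : (0 : ℚ) ≤ (62 : ℚ) + (25 : ℚ) * d + (2 : ℚ) * d ^ 2 + (21 : ℚ) * e + (4 : ℚ) * e * d + (2 : ℚ) * e ^ 2 := by positivity
    linarith
  · -- `a₃ = 1 + 1/f − s_Q ≤ 1 + 1/f ≤ 4/3`
    have h1 : (1 : ℚ) / f ≤ 1 / 3 := by rw [div_le_div_iff₀ hfpos (by norm_num)]; linarith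
    have h2 : 0 ≤ sQ := by rw [hsQ]; positivity
    simp only [a3]
    linarith
  · rw [hb0, div_le_iff₀ hden5]
    have : (4 : ℚ) / 3 * (12 * (f : ℚ) * ((f : ℚ) - 1) * ((f : ℚ) - 2)) -
        ((24 : ℚ) * (f:ℚ) + (-36 : ℚ) * (f:ℚ) ^ 2 + (12 : ℚ) * (f:ℚ) ^ 3 + (-24 : ℚ) * (q:ℚ) + (-9 : ℚ) * (q:ℚ) * (f:ℚ) +
        (36 : ℚ) * (q:ℚ) ^ 2 + (9 : ℚ) * (q:ℚ) ^ 2 * (f:ℚ) + (-12 : ℚ) * (q:ℚ) ^ 3) =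
        (300 : ℚ) + (26 : ℚ) * d + (60 : ℚ) * d ^ 2 + (4 : ℚ) * d ^ 3 + (320 : ℚ) * e + (21 : ℚ) * e * d + (12 : ℚ) * e * d ^ 2 +
        (87 : ℚ) * e ^ 2 + (3 : ℚ) * e ^ 2 * d + (7 : ℚ) * e ^ 3 := by rw [hqe, hfd]; ring
    have h0 : (0 : ℚ) ≤ (300 : ℚ) + (26 : ℚ) * d + (60 : ℚ) * d ^ 2 + (4 : ℚ) * d ^ 3 + (320 : ℚ) * e + (21 : ℚ) * e * d +
        (12 : ℚ) * e * d ^ 2 + (87 : ℚ) * e ^ 2 + (3 : ℚ) * e ^ 2 * d + (7 : ℚ) * e ^ 3 := by positivity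
    linarith
  · rw [hb1, div_le_iff₀ hden4]
    have : (4 : ℚ) / 3 * (12 * (f : ℚ) * ((f : ℚ) - 1)) - ((-8 : ℚ) + (-15 : ℚ) * (f:ℚ) + (12 : ℚ) * (f:ℚ) ^ 2 + (12 : ℚ) * (q:ℚ) +
        (3 : ℚ) * (q:ℚ) * (f:ℚ) + (-4 : ℚ) * (q:ℚ) ^ 2) =
        (110 : ℚ) + (29 : ℚ) * d + (4 : ℚ) * d ^ 2 + (47 : ℚ) * e + (5 : ℚ) * e * d + (5 : ℚ) * e ^ 2 := by rw [hqe, hfd]; ring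
    have h0 : (0 : ℚ) ≤ (110 : ℚ) + (29 : ℚ) * d + (4 : ℚ) * d ^ 2 + (47 : ℚ) * e + (5 : ℚ) * e * d + (5 : ℚ) * e ^ 2 := by positivity
    linarith
  · rw [hb2, div_le_iff₀ hden2]
    have : (4 : ℚ) / 3 * ((12 : ℚ) * (f:ℚ)) - ((8 : ℚ) + (15 : ℚ) * (f:ℚ) + (-4 : ℚ) * (q:ℚ)) = (22 : ℚ) + (1 : ℚ) * d + (5 : ℚ) * e := by
      rw [hqe, hfd]; ring
    have h0 : (0 : ℚ) ≤ (22 : ℚ) + (1 : ℚ) * d + (5 : ℚ) * e := by positivity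
    linarith
  · -- the KEY inequality `b₀ ≥ 3/4`
    rw [hb0, le_div_iff₀ hden5]
    have : ((24 : ℚ) * (f:ℚ) + (-36 : ℚ) * (f:ℚ) ^ 2 + (12 : ℚ) * (f:ℚ) ^ 3 + (-24 : ℚ) * (q:ℚ) + (-9 : ℚ) * (q:ℚ) * (f:ℚ) +
        (36 : ℚ) * (q:ℚ) ^ 2 + (9 : ℚ) * (q:ℚ) ^ 2 * (f:ℚ) + (-12 : ℚ) * (q:ℚ) ^ 3) -
        (3 : ℚ) / 4 * (12 * (f : ℚ) * ((f : ℚ) - 1) * ((f : ℚ) - 2)) =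
        (540 : ℚ) + (492 : ℚ) * d + (45 : ℚ) * d ^ 2 + (3 : ℚ) * d ^ 3 + (198 : ℚ) * e + (189 : ℚ) * e * d + (9 : ℚ) * e * d ^ 2 +
        (18 : ℚ) * e ^ 2 + (18 : ℚ) * e ^ 2 * d := by rw [hqe, hfd]; ring
    have h0 : (0 : ℚ) ≤ (540 : ℚ) + (492 : ℚ) * d + (45 : ℚ) * d ^ 2 + (3 : ℚ) * d ^ 3 + (198 : ℚ) * e + (189 : ℚ) * e * d +
        (9 : ℚ) * e * d ^ 2 + (18 : ℚ) * e ^ 2 + (18 : ℚ) * e ^ 2 * d := by positivity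
    linarith
  · simp only [a2]; field_simp; ring
  · simp only [a1]; field_simp; ring
  · simp only [a3]; field_simp; ring
  · simp only [b0]; ring
  · simp only [b1]; field_simp; ring
  · simp only [b2]; field_simp; ring
  · rw [hsQ]; field_simp; ring

end ThinGirth
end PercRepro
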